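import Summits.CriticalPhenomena.PercolationContinuityZ3.Theorems.PercNearOneGluingNoHeavyLowerTailQ7Three
import HarnessLib

/-!
# `NoHeavyLowerTail` (stmt-CriticalPhenomena-4575) — the STABILITY form of Kozma–Nitzan's Question 7 for three
# relays and of (GΨ₃): no reliability hypothesis, an explicit slack instead

Support file (`--supports stmt-CriticalPhenomena-4575`), coupling seat `prim-cplus-coupling` (gen 11).  No
definitions, no named facts, no sorries; standard axioms; independent of the CSH chain.

`Q7Psi.q7_three` (gen 9) is the pre-FKG inequality (41) of arXiv:2401.12397 for the DESIGNATED least `b`-reliable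
relay `z` of `A = {x, y, z}`: under `μ(z↔b) ≤ μ(x↔b)`, `μ(z↔b) ≤ μ(y↔b)` one has `μ({z↔b} ∩ {o↔A}) ≤ μ({o↔b} ∩ {o↔A})`.
For gluing / sprinkling arguments (prim-lf-3, LF3-BETA-R.md §16e: the ranking of the relays is known in one graph, the
inequality is needed in another) the hypothesis-free ROBUST form is the usable one:

* `Q7Psi.gpsi_three_robust` — for EVERY weight vector, distinct `x, y, z`, every `o`, every monotone cluster property
  `F`:  `min(E F(C x) − E F(C z), 0) + min(E F(C y) − E F(C z), 0) ≤ ∫_J F(C o) − ∫_J F(C z)`, `J = {o↔x} ∪ {o↔y}`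
  (`gpsi_three_robust_of_covTau` fed with `CovTau.covTau`; unconditional).
* `Q7Psi.q7_of_psi_robust` — the peeling step as an inequality between DIFFERENCES (pure event algebra):
  `μ({z↔b} ∩ {o↔A}) − μ({o↔b} ∩ {o↔A}) ≤ μ({z↔b} ∩ {o↔A in G∖b}) − μ({o↔b} ∩ {o↔A in G∖b})`.
* `Q7Psi.q7_three_robust` — **Question 7 for three relays with slack**: for `o, x, y, z ≠ b`, `x, y, z` distinct, NO
  reliability hypothesis:
  `μ({z↔b} ∩ {o↔A}) − μ({o↔b} ∩ {o↔A}) ≤ (μ(z↔b) − μ(x↔b))⁺ + (μ(z↔b) − μ(y↔b))⁺`, `A = {x, y, z}`;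
  `Q7Psi.q7_three_slack` — the `δ`-form: `μ(z↔b) ≤ μ(x↔b) + δx`, `μ(z↔b) ≤ μ(y↔b) + δy` imply
  `μ({z↔b} ∩ {o↔A}) ≤ μ({o↔b} ∩ {o↔A}) + δx + δy`.
The proof is the gen-9 assembly (`q7_of_psi`, the green bridge `real_inter_openConn_eq_integral_green`, (GΨ₃) on
`G ∖ b`) run with the robust (GΨ₃) inequality in place of the sharp one; every other step is an identity or a one-sided
bound that survives verbatim.
[cite: KozmaNitzan2024, Question 7 (p. 36), Conjectures 1–2 (p. 3), Lemma 5 (pp. 13–14), §5.1 (pp. 31–32)]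
-/

namespace Summit.CriticalPhenomena.PercolationContinuityZ3.Theorems

open MeasureTheory Set Literature.Probability.LatticeModels Literature.Probability.Percolation
open scoped Classical
open KNPreFKG BHK2006

noncomputable section

namespace Q7Psi

universe u

variable {V : Type u} [Fintype V]

/-- **Robust (GΨ₃), unconditionally.**  For every finite weighted graph, distinct relays `x, y, z`, every observer `o`
and every monotone real cluster property `F`:
`min(E F(C x) − E F(C z), 0) + min(E F(C y) − E F(C z), 0) ≤ ∫_{o↔x ∪ o↔y} F(C o) − ∫_{o↔x ∪ o↔y} F(C z)`.
(`gpsi_three_robust_of_covTau` fed with the tree theorem `CovTau.covTau`.)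
[cite: KozmaNitzan2024, §5.1 (pp. 31–32), Question 7 (p. 36)] -/
theorem gpsi_three_robust (w : Sym2 V → unitInterval) (o x y z : V) (hxy : x ≠ y) (hxz : x ≠ z) (hyz : y ≠ z)
    (F : Set V → ℝ) (hF : ∀ S T : Set V, S ⊆ T → F S ≤ F T) :
    min ((∫ ω, F (openCluster ω x) ∂(prodBernoulli w)) - ∫ ω, F (openCluster ω z) ∂(prodBernoulli w)) 0 +
        min ((∫ ω, F (openCluster ω y) ∂(prodBernoulli w)) - ∫ ω, F (openCluster ω z) ∂(prodBernoulli w)) 0 ≤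
      (∫ ω in (openConn o x ∪ openConn o y), F (openCluster ω o) ∂(prodBernoulli w)) -
        ∫ ω in (openConn o x ∪ openConn o y), F (openCluster ω z) ∂(prodBernoulli w) :=
  gpsi_three_robust_of_covTau (fun p _ x' y' o' v' hvx f hf => CovTau.covTau p x' y' o' v' hvx f hf)
    w o x y z hxy hxz hyz F hF

/-- **The peeling step as an inequality of differences** (pure event algebra, no hypothesis on `z`): for every finite
relay set `A`, observer `o`, target `b` and relay `z`,
`μ({z↔b} ∩ {o↔A}) − μ({o↔b} ∩ {o↔A}) ≤ μ({z↔b} ∩ {o↔A in G∖b}) − μ({o↔b} ∩ {o↔A in G∖b})`: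
on `{o↔A} ∖ {o↔A in G∖b}` the observer is joined to `b`. [cite: KozmaNitzan2024, Question 7 (p. 36)] -/
theorem q7_of_psi_robust (w : Sym2 V → unitInterval) (o b z : V) (A : Finset V) :
    (prodBernoulli w).real (openConn z b ∩ ⋃ a ∈ A, openConn o a) -
        (prodBernoulli w).real (openConn o b ∩ ⋃ a ∈ A, openConn o a) ≤
      (prodBernoulli w).real (openConn z b ∩ ⋃ a ∈ A, openConnIn ({b}ᶜ : Set V) o a) -
        (prodBernoulli w).real (openConn o b ∩ ⋃ a ∈ A, openConnIn ({b}ᶜ : Set V) o a) := by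
  set μ := prodBernoulli w with hμ
  set J : Set (BondConfig V) := ⋃ a ∈ A, openConnIn ({b}ᶜ : Set V) o a with hJ
  set U : Set (BondConfig V) := ⋃ a ∈ A, (openConn o a : Set (BondConfig V)) with hU
  -- `J ⊆ U` and `U ∖ J ⊆ {o ↔ b}`
  have hJU : J ⊆ U := by
    intro ω hω
    simp only [hJ, hU, mem_iUnion] at hω ⊢
    obtain ⟨a, ha, h⟩ := hω
    exact ⟨a, ha, KNPreFKG.reachable_of_openConnIn h⟩
  have hUJ : U \ J ⊆ (openConn o b : Set (BondConfig V)) := by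
    rintro ω ⟨hωU, hωJ⟩
    simp only [hJ, hU, mem_iUnion] at hωU hωJ
    obtain ⟨a, ha, h⟩ := hωU
    have hn : ω ∉ openConnIn ({b}ᶜ : Set V) o a := fun h' => hωJ ⟨a, ha, h'⟩
    exact reachable_of_not_openConnIn_compl h hn
  have msplit : ∀ X : Set (BondConfig V), μ.real (X ∩ U) = μ.real (X ∩ J) + μ.real (X ∩ (U \ J)) := by
    intro X
    have hdj : Disjoint (X ∩ J) (X ∩ (U \ J)) := by
      rw [Set.disjoint_left]
      rintro ω ⟨-, hωJ⟩ ⟨-, -, hωJ'⟩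
      exact hωJ' hωJ
    rw [← measureReal_union hdj MeasurableSet.of_discrete]
    congr 1
    ext ω
    simp only [mem_inter_iff, mem_union, mem_sdiff]
    constructor
    · rintro ⟨hX, hωU⟩
      by_cases hωJ : ω ∈ J
      · exact Or.inl ⟨hX, hωJ⟩
      · exact Or.inr ⟨hX, hωU, hωJ⟩
    · rintro (⟨hX, hωJ⟩ | ⟨hX, hωU, -⟩)
      · exact ⟨hX, hJU hωJ⟩
      · exact ⟨hX, hωU⟩
  have h1 : μ.real (openConn z b ∩ (U \ J)) ≤ μ.real (U \ J) := measureReal_mono inter_subset_right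
  have h2 : μ.real (openConn o b ∩ (U \ J)) = μ.real (U \ J) := by
    congr 1
    exact inter_eq_right.2 hUJ
  rw [msplit (openConn z b), msplit (openConn o b), h2]
  linarith

/-- **Kozma–Nitzan's Question 7 for three relays — STABILITY FORM (no reliability hypothesis).**  In a finite weighted
graph let `o, x, y, z ≠ b` and `x, y, z` distinct, `A = {x, y, z}`.  Then
`μ({z↔b} ∩ {o↔A}) − μ({o↔b} ∩ {o↔A}) ≤ (μ(z↔b) − μ(x↔b))⁺ + (μ(z↔b) − μ(y↔b))⁺`,
written with `min`: `min(μ(x↔b) − μ(z↔b), 0) + min(μ(y↔b) − μ(z↔b), 0) ≤ μ({o↔b} ∩ {o↔A}) − μ({z↔b} ∩ {o↔A})`.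
At `μ(z↔b) ≤ μ(x↔b), μ(y↔b)` this is `q7_three`.  Proof: `q7_of_psi_robust`, the `z`-part of the peeled event
contributes equally, the green bridge to `G ∖ b`, and `gpsi_three_robust` there.
[cite: KozmaNitzan2024, Question 7 (p. 36), Conjectures 1–2 (p. 3), Lemma 5 (pp. 13–14), §5.1 (pp. 31–32)] -/
theorem q7_three_robust (w : Sym2 V → unitInterval) (o b x y z : V) (hob : o ≠ b) (hxb : x ≠ b) (hyb : y ≠ b)
    (hzb : z ≠ b) (hxy : x ≠ y) (hxz : x ≠ z) (hyz : y ≠ z) :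
    min ((prodBernoulli w).real (openConn x b) - (prodBernoulli w).real (openConn z b)) 0 +
        min ((prodBernoulli w).real (openConn y b) - (prodBernoulli w).real (openConn z b)) 0 ≤
      (prodBernoulli w).real (openConn o b ∩ (openConn o x ∪ openConn o y ∪ openConn o z)) -
        (prodBernoulli w).real (openConn z b ∩ (openConn o x ∪ openConn o y ∪ openConn o z)) := by
  set μ := prodBernoulli w with hμ
  have hmeas : ∀ T : Set (BondConfig V), MeasurableSet T := fun _ => MeasurableSet.of_discrete
  -- (1) reduction to the peeled form
  have hA : ∀ X : Set (BondConfig V), X ∩ (⋃ a ∈ ({x, y, z} : Finset V), (openConn o a : Set (BondConfig V))) =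
      X ∩ (openConn o x ∪ openConn o y ∪ openConn o z) := by
    intro X; congr 1; ext ω; simp [or_assoc]
  have hred := q7_of_psi_robust w o b z ({x, y, z} : Finset V)
  rw [hA, hA] at hred
  set Jx : Set (BondConfig V) := openConnIn ({b}ᶜ : Set V) o x with hJx
  set Jy : Set (BondConfig V) := openConnIn ({b}ᶜ : Set V) o y with hJy
  set Jz : Set (BondConfig V) := openConnIn ({b}ᶜ : Set V) o z with hJz
  have hJ : ∀ X : Set (BondConfig V), X ∩ (⋃ a ∈ ({x, y, z} : Finset V), openConnIn ({b}ᶜ : Set V) o a) =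
      X ∩ ((Jx ∪ Jy) ∪ Jz) := by
    intro X; congr 1; ext ω; simp [hJx, hJy, hJz, or_assoc]
  rw [hJ, hJ] at hred
  -- (2) the `z`-part of the peeled event contributes equally to both sides
  have msplit : ∀ X : Set (BondConfig V), μ.real (X ∩ ((Jx ∪ Jy) ∪ Jz)) =
      μ.real (X ∩ (Jx ∪ Jy)) + μ.real (X ∩ Jz ∩ (Jx ∪ Jy)ᶜ) := by
    intro X
    have hdj : Disjoint (X ∩ (Jx ∪ Jy)) (X ∩ Jz ∩ (Jx ∪ Jy)ᶜ) := by
      rw [Set.disjoint_left]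
      rintro ω ⟨-, h⟩ ⟨-, hn⟩
      exact hn h
    rw [← measureReal_union hdj (hmeas _)]
    congr 1
    ext ω
    simp only [mem_inter_iff, mem_union, mem_compl_iff]
    tauto
  have hz_eq : openConn z b ∩ Jz ∩ (Jx ∪ Jy)ᶜ = openConn o b ∩ Jz ∩ (Jx ∪ Jy)ᶜ := by
    ext ω
    simp only [mem_inter_iff]
    constructor
    · rintro ⟨⟨hzb', hJ⟩, hn⟩
      exact ⟨⟨(reachable_of_openConnIn hJ).trans hzb', hJ⟩, hn⟩
    · rintro ⟨⟨hob', hJ⟩, hn⟩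
      exact ⟨⟨(reachable_of_openConnIn hJ).symm.trans hob', hJ⟩, hn⟩
  rw [msplit, msplit, hz_eq] at hred
  suffices key : min (μ.real (openConn x b) - μ.real (openConn z b)) 0 +
        min (μ.real (openConn y b) - μ.real (openConn z b)) 0 ≤
      μ.real (openConn o b ∩ (Jx ∪ Jy)) - μ.real (openConn z b ∩ (Jx ∪ Jy)) by linarith
  -- (3) pass to `G ∖ b`
  set S : Set V := {b}ᶜ with hS
  haveI : Fintype S := Fintype.ofFinite S
  set r := restrictConfig (Subtype.val : S → V) with hr
  set w' : Sym2 S → unitInterval := w ∘ Sym2.map (Subtype.val : S → V) with hw'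
  set μ' := prodBernoulli w' with hμ'
  set o' : S := ⟨o, mem_compl_singleton_iff.2 hob⟩ with ho'
  set x' : S := ⟨x, mem_compl_singleton_iff.2 hxb⟩ with hx'
  set y' : S := ⟨y, mem_compl_singleton_iff.2 hyb⟩ with hy'
  set z' : S := ⟨z, mem_compl_singleton_iff.2 hzb⟩ with hz'
  set E : Set (BondConfig S) := openConn o' x' ∪ openConn o' y' with hE
  have hJE : Jx ∪ Jy = r ⁻¹' E := by
    rw [hE, preimage_union, hr, preimage_openConn_val, preimage_openConn_val]
  -- the green function
  set F : Set S → ℝ := fun T => μ.real {ω₁ : BondConfig V | ∃ s ∈ Subtype.val '' T, s ≠ b ∧ s(b, s) ∈ ω₁} with hF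
  have hFmono : ∀ T T' : Set S, T ⊆ T' → F T ≤ F T' := by
    intro T T' hTT'
    refine measureReal_mono fun ω₁ hω₁ => ?_
    obtain ⟨s, hs, hsb, hso⟩ := hω₁
    exact ⟨s, image_mono hTT' hs, hsb, hso⟩
  have hbridge : ∀ (v : V) (hvb : v ≠ b) (E₁ : Set (BondConfig S)),
      μ.real (openConn v b ∩ r ⁻¹' E₁) = ∫ ω' in E₁, F (openCluster ω' ⟨v, mem_compl_singleton_iff.2 hvb⟩) ∂μ' := by
    intro v hvb E₁
    rw [inter_comm, hr, real_inter_openConn_eq_integral_green w b v hvb E₁, ← integral_indicator (hmeas _),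
      hμ', hw', ← integral_indicator (MeasurableSet.of_discrete), ← integral_comp_restrictConfig_val]
    refine integral_congr_ae (Filter.Eventually.of_forall fun ω => ?_)
    change (restrictConfig Subtype.val ⁻¹' E₁).indicator _ ω = E₁.indicator _ (restrictConfig Subtype.val ω)
    have hfun : (fun ω : BondConfig V => μ.real {ω₁ : BondConfig V | ∃ s ∈ {y | ω ∈ openConnIn ({b}ᶜ : Set V) v y},
        s ≠ b ∧ s(b, s) ∈ ω₁}) =
        (fun ω' => F (openCluster ω' ⟨v, mem_compl_singleton_iff.2 hvb⟩)) ∘ restrictConfig (Subtype.val : S → V) := by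
      funext ω
      simp only [Function.comp_apply, hF]
      rw [setOf_openConnIn_eq_image b ω ⟨v, mem_compl_singleton_iff.2 hvb⟩]
    rw [hfun]
    exact indicator_comp_right _
  -- the reliabilities through the bridge (`E₁ = univ`)
  have htau : ∀ (v : V) (hvb : v ≠ b), μ.real (openConn v b) =
      ∫ ω', F (openCluster ω' ⟨v, mem_compl_singleton_iff.2 hvb⟩) ∂μ' := by
    intro v hvb
    rw [← setIntegral_univ, ← hbridge v hvb univ, preimage_univ, inter_univ]
  have hxy' : x' ≠ y' := fun h => hxy (congrArg Subtype.val h)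
  have hxz' : x' ≠ z' := fun h => hxz (congrArg Subtype.val h)
  have hyz' : y' ≠ z' := fun h => hyz (congrArg Subtype.val h)
  rw [hJE, hbridge z hzb E, hbridge o hob E, htau x hxb, htau y hyb, htau z hzb]
  exact gpsi_three_robust w' o' x' y' z' hxy' hxz' hyz' F hFmono

/-- **Question 7 for three relays with `δ`-slack in the hypotheses.**  For `o, x, y, z ≠ b`, `x, y, z` distinct,
`A = {x, y, z}`: if `μ(z↔b) ≤ μ(x↔b) + δx` and `μ(z↔b) ≤ μ(y↔b) + δy` with `δx, δy ≥ 0`, then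
`μ({z↔b} ∩ {o↔A}) ≤ μ({o↔b} ∩ {o↔A}) + δx + δy`.  (`δx = δy = 0` is `q7_three`.)
[cite: KozmaNitzan2024, Question 7 (p. 36), Conjectures 1–2 (p. 3)] -/
theorem q7_three_slack (w : Sym2 V → unitInterval) (o b x y z : V) (hob : o ≠ b) (hxb : x ≠ b) (hyb : y ≠ b)
    (hzb : z ≠ b) (hxy : x ≠ y) (hxz : x ≠ z) (hyz : y ≠ z) (δx δy : ℝ) (hδx : 0 ≤ δx) (hδy : 0 ≤ δy)
    (hzx : (prodBernoulli w).real (openConn z b) ≤ (prodBernoulli w).real (openConn x b) + δx)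
    (hzy : (prodBernoulli w).real (openConn z b) ≤ (prodBernoulli w).real (openConn y b) + δy) :
    (prodBernoulli w).real (openConn z b ∩ (openConn o x ∪ openConn o y ∪ openConn o z)) ≤
      (prodBernoulli w).real (openConn o b ∩ (openConn o x ∪ openConn o y ∪ openConn o z)) + δx + δy := by
  have key := q7_three_robust w o b x y z hob hxb hyb hzb hxy hxz hyz
  have h1 : -δx ≤ min ((prodBernoulli w).real (openConn x b) - (prodBernoulli w).real (openConn z b)) 0 :=
    le_min (by linarith) (by linarith)
  have h2 : -δy ≤ min ((prodBernoulli w).real (openConn y b) - (prodBernoulli w).real (openConn z b)) 0 :=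
    le_min (by linarith) (by linarith)
  linarith

/-- **`Finset` form of the stability inequality** (the shape of `q7_of_psi_robust`, `A = {x, y, z}`).
[cite: KozmaNitzan2024, Question 7 (p. 36)] -/
theorem q7_three_robust_finset (w : Sym2 V → unitInterval) (o b x y z : V) (hob : o ≠ b) (hxb : x ≠ b)
    (hyb : y ≠ b) (hzb : z ≠ b) (hxy : x ≠ y) (hxz : x ≠ z) (hyz : y ≠ z) :
    min ((prodBernoulli w).real (openConn x b) - (prodBernoulli w).real (openConn z b)) 0 +
        min ((prodBernoulli w).real (openConn y b) - (prodBernoulli w).real (openConn z b)) 0 ≤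
      (prodBernoulli w).real (openConn o b ∩ ⋃ a ∈ ({x, y, z} : Finset V), (openConn o a : Set (BondConfig V))) -
        (prodBernoulli w).real
          (openConn z b ∩ ⋃ a ∈ ({x, y, z} : Finset V), (openConn o a : Set (BondConfig V))) := by
  have hA : ∀ X : Set (BondConfig V), X ∩ (⋃ a ∈ ({x, y, z} : Finset V), (openConn o a : Set (BondConfig V))) =
      X ∩ (openConn o x ∪ openConn o y ∪ openConn o z) := by
    intro X; congr 1; ext ω; simp [or_assoc]
  rw [hA, hA]
  exact q7_three_robust w o b x y z hob hxb hyb hzb hxy hxz hyz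

end Q7Psi

end

end Summit.CriticalPhenomena.PercolationContinuityZ3.Theorems
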